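import Summits.CriticalPhenomena.SAWScalingLimit.Theorems.FKGToTraversalBound.Negative.DeepEndpointGap

/-!
# SAW restriction and domain-Markov identities at graph level

Crux `SAWLeftRightFKG.FKGToTraversalBound` (stmt-CriticalPhenomena-1878), line `excursion-domination`: registered
sub-goal `stub_sawDomainMarkov` (chart step (a), DOMAIN MARKOV, of `stub_shellIteration`; written by its stub worker,
registered by the lead).  Exact identities between the critical SAW weights `SAW.weight Ω δ a b = Σ_γ x_c^{|γ|} δ_γ`
on the chords of `Ω_δ = discreteDomainGraph Ω δ`, stated DEF-FREE over tree names: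
* `weight_eq_tsum_indicator`, `weight_eq_tsum_preimage` — `w(S)` as a sum; transfer along injections;
* `weight_restrict` — RESTRICTION: if `Ω'_δ` is `Ω_δ` with the sites of `K` isolated and `a ∉ K`, then
  `w_{Ω'}(P) = w_Ω(avoid K ∧ P)` for events read on the vertex sequence (`Walk.mapLe` / `Walk.transfer`);
* `weight_prefix` — PREFIX identity: `w_{Ω,a,b}(γ = π · q ∧ P(q)) = x_c^{|π|} · w_{Ω,t,b}(q meets π only at t ∧ P(q))`;
* `weight_prefix_restrict` (= `stub_sawDomainMarkov` with explicit binders) — the future after a self-avoiding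
  prefix `π : a → t` is the critical chord of ANY `Ω'` whose graph is `Ω_δ` with a set `K ∌ t` of sites isolated,
  `K ⊇ π ∖ {t}`, the other sites of `K` cut off from `b` by `π ∖ {t}`:
  `w_{Ω,a,b}(γ = π · q ∧ P(q)) = x_c^{|π|} · w_{Ω',t,b}(P)` — the lattice form of
  `P(γ|[t,1] ∈ · | γ|[0,t]) = P^{U ∖ γ[0,t], γ(t), b}` (Kemppainen–Smirnov 2017, Remark 2.8);
* `toCurve_eq_of_support_eq`, `weight_congr_of_graph_eq`, `law_congr_of_graph_eq`,
  `law_setOf_hasTraversals_congr` — transport along a graph EQUALITY (the skeleton's `Presentable`);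
* `law_prefix_restrict` — probability form `P_{Ω,a,b}(γ = π·q ∧ P(q)) = P_{Ω,a,b}(γ = π·q) · P_{Ω',t,b}(P)`.
Only theorems; no named fact; axioms are the standard three.
-/

noncomputable section

open MeasureTheory Set
open scoped ENNReal
open Literature.Probability.LatticeModels
open Literature.Probability.RandomPlanarGeometry
open Literature.Probability.RandomPlanarGeometry.SAW

namespace Summit.CriticalPhenomena.SAWScalingLimit.Theorems.FKGToTraversalBound.ExcursionDomination

variable {Ω Ω' : Set ℂ} {δ : ℝ} {a b t : Site 2}

/-! ### Chords are determined by their vertex sequence -/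

/-- Two chords with the same underlying walk are equal. [folklore] -/
theorem domainSAW_ext_walk {γ₁ γ₂ : DomainSAW Ω δ a b} (h : γ₁.walk = γ₂.walk) : γ₁ = γ₂ := by
  cases γ₁; cases γ₂; cases h; rfl

/-- Two chords with the same vertex sequence are equal (a walk of a simple graph is determined by its
support). [folklore] -/
theorem domainSAW_ext_support {γ₁ γ₂ : DomainSAW Ω δ a b}
    (h : γ₁.walk.support = γ₂.walk.support) : γ₁ = γ₂ :=
  domainSAW_ext_walk (SimpleGraph.Walk.ext_support h)

/-- The mesh polyline of a walk depends only on its vertex sequence (walks of possibly different graphs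
on the same vertex type). [folklore] -/
theorem toCurve_eq_of_support_eq {V E : Type*} [AddCommGroup E] [Module ℝ E] [TopologicalSpace E]
    [ContinuousAdd E] [ContinuousSMul ℝ E] {G G' : SimpleGraph V} {u v u' v' : V} (emb : V → E)
    {p : G.Walk u v} {q : G'.Walk u' v'} (h : p.support = q.support) :
    p.toCurve emb = q.toCurve emb := by
  unfold SimpleGraph.Walk.toCurve
  rw [h]

/-! ### The weight as a sum; transfer along injections -/

/-- `w(S) = Σ_γ 1_S(γ) · x_c^{|γ|}`. [folklore] -/
theorem weight_eq_tsum_indicator (S : Set (DomainSAW Ω δ a b)) :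
    weight Ω δ a b S =
      ∑' γ, S.indicator (fun γ => ENNReal.ofReal (criticalFugacity ^ γ.length)) γ := by
  rw [weight, Measure.sum_apply _ MeasurableSpace.measurableSet_top]
  refine tsum_congr fun γ => ?_
  rw [Measure.smul_apply, smul_eq_mul, Measure.dirac_apply' _ MeasurableSpace.measurableSet_top]
  by_cases hγ : γ ∈ S
  · rw [Set.indicator_of_mem hγ, Set.indicator_of_mem hγ, Pi.one_apply, mul_one]
  · rw [Set.indicator_of_notMem hγ, Set.indicator_of_notMem hγ, mul_zero]

/-- **Transfer along an injection.**  If `Φ : ι → chords` is injective and the event `S` lies in its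
range, then `w(S) = Σ_i 1_{Φ⁻¹ S}(i) · x_c^{|Φ i|}`. [folklore] -/
theorem weight_eq_tsum_preimage {ι : Type*} (Φ : ι → DomainSAW Ω δ a b)
    (hΦ : Function.Injective Φ) {S : Set (DomainSAW Ω δ a b)} (hS : S ⊆ Set.range Φ) :
    weight Ω δ a b S =
      ∑' i, (Φ ⁻¹' S).indicator (fun i => ENNReal.ofReal (criticalFugacity ^ (Φ i).length)) i := by
  rw [weight_eq_tsum_indicator,
    ← hΦ.tsum_eq (f := S.indicator fun γ => ENNReal.ofReal (criticalFugacity ^ γ.length))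
      (Set.support_indicator_subset.trans hS)]
  exact tsum_congr fun i => (Set.indicator_comp_right Φ).symm

/-! ### Walk combinatorics -/

/-- A walk of a graph none of whose edges ENTERS `K`, started off `K`, stays off `K`. [folklore] -/
theorem forall_support_notMem_of_adj {V : Type*} {G : SimpleGraph V} {K : Set V}
    (hK : ∀ ⦃x y : V⦄, G.Adj x y → y ∉ K) :
    ∀ {u v : V} (p : G.Walk u v), u ∉ K → ∀ x ∈ p.support, x ∉ K := by
  intro u v p
  induction p with
  | nil => intro hu x hx; rw [SimpleGraph.Walk.support_nil, List.mem_singleton] at hx; exact hx ▸ hu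
  | cons h p ih =>
    intro hu x hx
    rw [SimpleGraph.Walk.support_cons, List.mem_cons] at hx
    exact hx.elim (fun hx => hx ▸ hu) (ih (hK h) x)

/-- If `G'` contains every edge of `G` between sites off `K`, a walk of `G` avoiding `K` has all its edges
in `G'`. [folklore] -/
theorem edges_mem_edgeSet_of_support {V : Type*} {G G' : SimpleGraph V} {K : Set V}
    (hGG' : ∀ ⦃x y : V⦄, G.Adj x y → x ∉ K → y ∉ K → G'.Adj x y) :
    ∀ {u v : V} (p : G.Walk u v), (∀ x ∈ p.support, x ∉ K) →
      ∀ e, e ∈ p.edges → e ∈ G'.edgeSet := by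
  intro u v p
  induction p with
  | nil => intro _ e he; simp at he
  | cons h p ih =>
    intro hs e he
    rw [SimpleGraph.Walk.edges_cons, List.mem_cons] at he
    rw [SimpleGraph.Walk.support_cons] at hs
    rcases he with rfl | he
    · exact (SimpleGraph.mem_edgeSet G').2
        (hGG' h (hs _ List.mem_cons_self) (hs _ (List.mem_cons_of_mem _ p.start_mem_support)))
    · exact ih (fun x hx => hs x (List.mem_cons_of_mem _ hx)) e he

/-- Left cancellation of `Walk.append`. [folklore] -/
theorem append_left_cancel {V : Type*} {G : SimpleGraph V} {u v w : V} (p : G.Walk u v)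
    {q₁ q₂ : G.Walk v w} (h : p.append q₁ = p.append q₂) : q₁ = q₂ := by
  apply SimpleGraph.Walk.ext_support
  have hs := congrArg SimpleGraph.Walk.support h
  rw [SimpleGraph.Walk.support_append, SimpleGraph.Walk.support_append] at hs
  have htail := List.append_cancel_left hs
  rw [← q₁.cons_tail_support, ← q₂.cons_tail_support, htail]

/-- A concatenation `p · q` is self-avoiding iff both pieces are and `q` meets `p` only at the junction.
[folklore] -/
theorem isPath_append_iff {V : Type*} {G : SimpleGraph V} {u v w : V} (p : G.Walk u v)
    (q : G.Walk v w) :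
    (p.append q).IsPath ↔ p.IsPath ∧ q.IsPath ∧ ∀ x ∈ q.support, x ∈ p.support → x = v := by
  rw [SimpleGraph.Walk.isPath_def, SimpleGraph.Walk.isPath_def, SimpleGraph.Walk.isPath_def,
    SimpleGraph.Walk.support_append, List.nodup_append, ← q.cons_tail_support, List.nodup_cons]
  constructor
  · rintro ⟨hp, htail, hdisj⟩
    have hv : v ∉ q.support.tail := fun hv => hdisj v p.end_mem_support v hv rfl
    refine ⟨hp, ⟨hv, htail⟩, ?_⟩
    intro x hx hxp
    rcases List.mem_cons.1 hx with rfl | hx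
    · rfl
    · exact absurd rfl (hdisj x hxp x hx)
  · rintro ⟨hp, ⟨hv, htail⟩, hcompat⟩
    refine ⟨hp, htail, ?_⟩
    intro x hxp y hy hxy
    subst hxy
    have := hcompat x (List.mem_cons_of_mem _ hy) hxp
    subst this
    exact hv hy

/-- **Cut lemma.**  For chords from `t` to `b`: if `K ⊇ K₀` and no site of `K ∖ K₀` is joined to `b` by
a walk of `Ω_δ` avoiding `K₀`, then avoiding `K` is the same event as avoiding `K₀`. [folklore] -/
theorem forall_support_notMem_iff_of_cut {K K₀ : Set (Site 2)} (hK₀ : K₀ ⊆ K)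
    (hcut : ∀ v ∈ K, v ∉ K₀ → ∀ p : (discreteDomainGraph Ω δ).Walk v b, ∃ x ∈ p.support, x ∈ K₀)
    (γ : DomainSAW Ω δ t b) :
    (∀ v ∈ γ.walk.support, v ∉ K) ↔ (∀ v ∈ γ.walk.support, v ∉ K₀) := by
  classical
  refine ⟨fun h v hv hv₀ => h v hv (hK₀ hv₀), fun h v hv hvK => ?_⟩
  have hv₀ : v ∉ K₀ := h v hv
  obtain ⟨x, hx, hxK₀⟩ := hcut v hvK hv₀ (γ.walk.dropUntil v hv)
  exact h x (SimpleGraph.Walk.support_dropUntil_subset_support γ.walk hv hx) hxK₀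

/-! ### The restriction identity -/

/-- **Restriction identity.**  If the graph `Ω'_δ` is the graph `Ω_δ` with the sites of `K` isolated
and `a ∉ K`, then for every event `P` read on the vertex sequence the `x_c`-weight of `P` among the
chords of `Ω'_δ` from `a` to `b` equals the `x_c`-weight of `P ∧ (avoid K)` among the chords of `Ω_δ`:
`γ' ↦ γ'.walk.mapLe _` is a length- and support-preserving bijection onto the chords avoiding `K`
(inverse `Walk.transfer`).  With `P := True` and `P := avoid H` this identifies both sides of
`SAWCollarBound` in a slit domain with restricted weights of the original domain. [folklore] -/
theorem weight_restrict {K : Set (Site 2)}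
    (hadj : ∀ x y, (discreteDomainGraph Ω' δ).Adj x y ↔
      ((discreteDomainGraph Ω δ).Adj x y ∧ x ∉ K ∧ y ∉ K))
    (ha : a ∉ K) (P : List (Site 2) → Prop) :
    weight Ω' δ a b {γ' | P γ'.walk.support} =
      weight Ω δ a b {γ | (∀ v ∈ γ.walk.support, v ∉ K) ∧ P γ.walk.support} := by
  classical
  have hle : discreteDomainGraph Ω' δ ≤ discreteDomainGraph Ω δ :=
    fun x y h => ((hadj x y).1 h).1
  let Φ : DomainSAW Ω' δ a b → DomainSAW Ω δ a b :=
    fun γ' => ⟨γ'.walk.mapLe hle, γ'.isPath.mapLe hle⟩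
  have hsupp : ∀ γ', (Φ γ').walk.support = γ'.walk.support :=
    fun γ' => SimpleGraph.Walk.support_mapLe_eq_support hle γ'.walk
  have hlen : ∀ γ', (Φ γ').length = γ'.length :=
    fun γ' => SimpleGraph.Walk.length_map _ _
  have hΦ : Function.Injective Φ := by
    intro γ₁ γ₂ h
    apply domainSAW_ext_support
    rw [← hsupp γ₁, ← hsupp γ₂, h]
  have havoid : ∀ γ' : DomainSAW Ω' δ a b, ∀ v ∈ γ'.walk.support, v ∉ K :=
    fun γ' => forall_support_notMem_of_adj (fun x y h => ((hadj x y).1 h).2.2) γ'.walk ha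
  have hrange : ∀ γ : DomainSAW Ω δ a b, (∀ v ∈ γ.walk.support, v ∉ K) → γ ∈ Set.range Φ := by
    intro γ hγ
    have hedges : ∀ e, e ∈ γ.walk.edges → e ∈ (discreteDomainGraph Ω' δ).edgeSet :=
      edges_mem_edgeSet_of_support (G' := discreteDomainGraph Ω' δ)
        (fun x y h hx hy => (hadj x y).2 ⟨h, hx, hy⟩) γ.walk hγ
    refine ⟨⟨γ.walk.transfer _ hedges, γ.isPath.transfer hedges⟩, ?_⟩
    apply domainSAW_ext_support
    rw [hsupp, SimpleGraph.Walk.support_transfer]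
  have hS : {γ : DomainSAW Ω δ a b | (∀ v ∈ γ.walk.support, v ∉ K) ∧ P γ.walk.support} ⊆
      Set.range Φ := fun γ hγ => hrange γ hγ.1
  rw [weight_eq_tsum_preimage Φ hΦ hS, weight_eq_tsum_indicator]
  refine tsum_congr fun γ' => ?_
  have hmem : γ' ∈ Φ ⁻¹' {γ : DomainSAW Ω δ a b |
      (∀ v ∈ γ.walk.support, v ∉ K) ∧ P γ.walk.support} ↔ P γ'.walk.support := by
    rw [Set.mem_preimage, Set.mem_setOf_eq, hsupp]
    exact ⟨fun h => h.2, fun h => ⟨havoid γ', h⟩⟩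
  by_cases h : P γ'.walk.support
  · rw [Set.indicator_of_mem (hmem.2 h),
      Set.indicator_of_mem (show γ' ∈ {γ' : DomainSAW Ω' δ a b | P γ'.walk.support} from h), hlen]
  · rw [Set.indicator_of_notMem (fun h' => h (hmem.1 h')),
      Set.indicator_of_notMem (show γ' ∉ {γ' : DomainSAW Ω' δ a b | P γ'.walk.support} from h)]

/-- The restriction identity for the total mass: `Z_{Ω'}(a,b) = w_Ω(avoid K)`. [folklore] -/
theorem weight_restrict_univ {K : Set (Site 2)}
    (hadj : ∀ x y, (discreteDomainGraph Ω' δ).Adj x y ↔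
      ((discreteDomainGraph Ω δ).Adj x y ∧ x ∉ K ∧ y ∉ K))
    (ha : a ∉ K) :
    weight Ω' δ a b Set.univ = weight Ω δ a b {γ | ∀ v ∈ γ.walk.support, v ∉ K} := by
  have h := weight_restrict (a := a) (b := b) hadj ha (fun _ => True)
  simp only [and_true] at h
  exact h.symm ▸ rfl

/-! ### The prefix identity (domain Markov property of the `x_c`-weights) -/

/-- **Prefix identity.**  For a self-avoiding prefix `π : a → t` of `Ω_δ` and any event `P` read on the
vertex sequence of the future, the `x_c`-weight of the chords `a → b` of the form `π · q` with `P(q)` is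
`x_c^{|π|}` times the `x_c`-weight of the chords `q : t → b` meeting `π` only at `t` with `P(q)`:
`q ↦ π · q` is a bijection multiplying lengths' weights by `x_c^{|π|}`. [folklore] -/
theorem weight_prefix (π : (discreteDomainGraph Ω δ).Walk a t) (hπ : π.IsPath)
    (P : List (Site 2) → Prop) :
    weight Ω δ a b {γ | ∃ q : (discreteDomainGraph Ω δ).Walk t b,
        γ.walk = π.append q ∧ P q.support} =
      ENNReal.ofReal (criticalFugacity ^ π.length) *
        weight Ω δ t b {γ' | (∀ v ∈ γ'.walk.support, v ∈ π.support → v = t) ∧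
          P γ'.walk.support} := by
  classical
  set C : Set (DomainSAW Ω δ t b) := {γ' | ∀ v ∈ γ'.walk.support, v ∈ π.support → v = t} with hC
  let Φ : C → DomainSAW Ω δ a b := fun γ' =>
    ⟨π.append γ'.1.walk, (isPath_append_iff π γ'.1.walk).2 ⟨hπ, γ'.1.isPath, γ'.2⟩⟩
  have hwalk : ∀ γ' : C, (Φ γ').walk = π.append γ'.1.walk := fun _ => rfl
  have hlen : ∀ γ' : C, (Φ γ').length = π.length + γ'.1.length :=
    fun γ' => SimpleGraph.Walk.length_append _ _
  have hΦ : Function.Injective Φ := by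
    rintro ⟨γ₁, h₁⟩ ⟨γ₂, h₂⟩ h
    have h' : π.append γ₁.walk = π.append γ₂.walk := by
      rw [← hwalk ⟨γ₁, h₁⟩, ← hwalk ⟨γ₂, h₂⟩, h]
    exact Subtype.ext (domainSAW_ext_walk (append_left_cancel π h'))
  set S : Set (DomainSAW Ω δ a b) :=
    {γ | ∃ q : (discreteDomainGraph Ω δ).Walk t b, γ.walk = π.append q ∧ P q.support} with hSdef
  set S' : Set (DomainSAW Ω δ t b) :=
    {γ' | (∀ v ∈ γ'.walk.support, v ∈ π.support → v = t) ∧ P γ'.walk.support} with hS'def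
  have hS : S ⊆ Set.range Φ := by
    rintro γ ⟨q, hq, -⟩
    have hpath : (π.append q).IsPath := hq ▸ γ.isPath
    obtain ⟨-, hqp, hcompat⟩ := (isPath_append_iff π q).1 hpath
    exact ⟨⟨⟨q, hqp⟩, hcompat⟩, domainSAW_ext_walk (by rw [hwalk, hq])⟩
  have hmem : ∀ γ' : C, (γ' ∈ Φ ⁻¹' S ↔ (γ'.1 ∈ S')) := by
    rintro ⟨γ', hγ'⟩
    simp only [Set.mem_preimage, hSdef, hS'def, Set.mem_setOf_eq]
    constructor
    · rintro ⟨q, hq, hP⟩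
      have hq' : γ'.walk = q := append_left_cancel π hq
      exact ⟨hγ', hq' ▸ hP⟩
    · rintro ⟨-, hP⟩
      exact ⟨γ'.walk, rfl, hP⟩
  have hxc : 0 ≤ criticalFugacity := criticalFugacity_pos_lt_one'.1.le
  have key : ∀ γ' : C,
      (Φ ⁻¹' S).indicator (fun i => ENNReal.ofReal (criticalFugacity ^ (Φ i).length)) γ' =
        S'.indicator (fun γ' => ENNReal.ofReal (criticalFugacity ^ π.length) *
          ENNReal.ofReal (criticalFugacity ^ γ'.length)) γ'.1 := by
    intro γ'
    by_cases h : γ'.1 ∈ S'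
    · rw [Set.indicator_of_mem ((hmem γ').2 h), Set.indicator_of_mem h, hlen, pow_add,
        ENNReal.ofReal_mul (pow_nonneg hxc _)]
    · rw [Set.indicator_of_notMem (fun h' => h ((hmem γ').1 h')), Set.indicator_of_notMem h]
  rw [weight_eq_tsum_preimage Φ hΦ hS, tsum_congr key,
    tsum_subtype C (S'.indicator fun γ' => ENNReal.ofReal (criticalFugacity ^ π.length) *
      ENNReal.ofReal (criticalFugacity ^ γ'.length)),
    Set.indicator_indicator, Set.inter_eq_right.2 (fun γ' hγ' => hγ'.1), weight_eq_tsum_indicator,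
    ← ENNReal.tsum_mul_left]
  exact tsum_congr fun γ' => Set.indicator_const_mul _ _ _ _

/-- **Domain Markov property at graph level** (restriction + prefix).  Let `π : a → t` be a self-avoiding
prefix in `Ω_δ`, and let `Ω'` be any domain whose graph `Ω'_δ` is `Ω_δ` with a set `K ∌ t` of sites
isolated, where `K` contains the sites of `π` other than `t` and every other site of `K` is cut from `b`
by `π ∖ {t}` (sealed pockets, dropped components).  Then for every event `P` read on the vertex sequence
of the future, `w_{Ω,a,b}(γ = π · q ∧ P(q)) = x_c^{|π|} · w_{Ω',t,b}(P)`: the conditional law of the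
future given the prefix is the critical chord measure of `Ω'_δ` from the tip `t` to `b`
(Kemppainen–Smirnov 2017, Remark 2.8, for the `x_c`-SAW). [folklore] -/
theorem weight_prefix_restrict {K : Set (Site 2)} (π : (discreteDomainGraph Ω δ).Walk a t)
    (hπ : π.IsPath)
    (hadj : ∀ x y, (discreteDomainGraph Ω' δ).Adj x y ↔
      ((discreteDomainGraph Ω δ).Adj x y ∧ x ∉ K ∧ y ∉ K))
    (ht : t ∉ K) (hπK : ∀ v ∈ π.support, v ≠ t → v ∈ K)
    (hcut : ∀ v ∈ K, v ∉ π.support →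
      ∀ p : (discreteDomainGraph Ω δ).Walk v b, ∃ x ∈ p.support, x ∈ π.support ∧ x ≠ t)
    (P : List (Site 2) → Prop) :
    weight Ω δ a b {γ | ∃ q : (discreteDomainGraph Ω δ).Walk t b,
        γ.walk = π.append q ∧ P q.support} =
      ENNReal.ofReal (criticalFugacity ^ π.length) * weight Ω' δ t b {γ' | P γ'.walk.support} := by
  rw [weight_prefix π hπ P, weight_restrict hadj ht P]
  congr 2
  ext γ
  simp only [Set.mem_setOf_eq]
  rw [forall_support_notMem_iff_of_cut (Ω := Ω) (δ := δ) (t := t) (b := b) (K := K)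
    (K₀ := {v | v ∈ π.support ∧ v ≠ t}) (fun v hv => hπK v hv.1 hv.2)
    (fun v hv hv₀ p => hcut v hv (fun h => hv₀ ⟨h, fun hvt => ht (hvt ▸ hv)⟩) p) γ]
  simp only [Set.mem_setOf_eq, not_and, not_not]

/-! ### Transport along a presentation (graph equality) -/

/-- Chord weights of events read on the vertex sequence depend only on the graph `Ω_δ` (transport of
`DomainSAW` along `discreteDomainGraph Ω' δ = discreteDomainGraph Ω δ`, the graph equality of the
skeleton's `Presentable`). [folklore] -/
theorem weight_congr_of_graph_eq (hG : discreteDomainGraph Ω' δ = discreteDomainGraph Ω δ)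
    (P : List (Site 2) → Prop) :
    weight Ω' δ a b {γ' | P γ'.walk.support} = weight Ω δ a b {γ | P γ.walk.support} := by
  have hadj : ∀ x y, (discreteDomainGraph Ω' δ).Adj x y ↔
      ((discreteDomainGraph Ω δ).Adj x y ∧ x ∉ (∅ : Set (Site 2)) ∧ y ∉ (∅ : Set (Site 2))) := by
    intro x y
    rw [hG]
    simp
  rw [weight_restrict hadj (Set.notMem_empty a) P]
  congr 1
  ext γ
  simp

/-- The critical SAW law of an event read on the vertex sequence depends only on the graph `Ω_δ`.
[folklore] -/
theorem law_congr_of_graph_eq (hG : discreteDomainGraph Ω' δ = discreteDomainGraph Ω δ)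
    (P : List (Site 2) → Prop) :
    law Ω' δ a b {γ' | P γ'.walk.support} = law Ω δ a b {γ | P γ.walk.support} := by
  have hu := weight_congr_of_graph_eq (a := a) (b := b) hG (fun _ => True)
  simp only [Set.setOf_true] at hu
  simp only [law, Measure.smul_apply, smul_eq_mul]
  rw [hu, weight_congr_of_graph_eq hG P]

/-- In particular the traversal-count events of `ShellTight` are transported verbatim along a
presentation `discreteDomainGraph D.carrier δ = discreteDomainGraph (dom C δ) δ`. [folklore] -/
theorem law_setOf_hasTraversals_congr (hG : discreteDomainGraph Ω' δ = discreteDomainGraph Ω δ)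
    (n : ℕ) (x : ℂ) (ρ R : ℝ) :
    law Ω' δ a b {γ' | (⟨γ'.walk.toCurve (meshPoint δ)⟩ : Curve ℂ).HasTraversals n x ρ R} =
      law Ω δ a b {γ | (⟨γ.walk.toCurve (meshPoint δ)⟩ : Curve ℂ).HasTraversals n x ρ R} :=
  law_congr_of_graph_eq hG
    (fun l => (⟨polyline (l.map (meshPoint δ))⟩ : Curve ℂ).HasTraversals n x ρ R)

/-! ### The conditional law of the future -/

/-- **Conditional law of the future given a prefix** (probability form of `weight_prefix_restrict`):
`P_{Ω,a,b}(γ = π · q ∧ P(q)) = P_{Ω,a,b}(γ = π · q) · P_{Ω',t,b}(P)` whenever the future's total mass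
`Z_{Ω'}(t,b)` is finite (it is, for a bounded domain and `δ > 0`).  If `Z_{Ω'}(t,b) = 0` both sides
vanish. [folklore] -/
theorem law_prefix_restrict {K : Set (Site 2)} (π : (discreteDomainGraph Ω δ).Walk a t)
    (hπ : π.IsPath)
    (hadj : ∀ x y, (discreteDomainGraph Ω' δ).Adj x y ↔
      ((discreteDomainGraph Ω δ).Adj x y ∧ x ∉ K ∧ y ∉ K))
    (ht : t ∉ K) (hπK : ∀ v ∈ π.support, v ≠ t → v ∈ K)
    (hcut : ∀ v ∈ K, v ∉ π.support →
      ∀ p : (discreteDomainGraph Ω δ).Walk v b, ∃ x ∈ p.support, x ∈ π.support ∧ x ≠ t)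
    (hfin : weight Ω' δ t b Set.univ ≠ ∞) (P : List (Site 2) → Prop) :
    law Ω δ a b {γ | ∃ q : (discreteDomainGraph Ω δ).Walk t b,
        γ.walk = π.append q ∧ P q.support} =
      law Ω δ a b {γ | ∃ q : (discreteDomainGraph Ω δ).Walk t b, γ.walk = π.append q} *
        law Ω' δ t b {γ' | P γ'.walk.support} := by
  have h1 := weight_prefix_restrict π hπ hadj ht hπK hcut P
  have h2 := weight_prefix_restrict π hπ hadj ht hπK hcut (fun _ => True)
  simp only [and_true, Set.setOf_true] at h2
  simp only [law, Measure.smul_apply, smul_eq_mul]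
  rw [h1, h2]
  set Z := weight Ω δ a b Set.univ
  set c := ENNReal.ofReal (criticalFugacity ^ π.length)
  set w₁ := weight Ω' δ t b Set.univ with hw₁
  set wP := weight Ω' δ t b {γ' | P γ'.walk.support}
  by_cases hw : w₁ = 0
  · have hwP : wP = 0 := le_antisymm ((measure_mono (Set.subset_univ _)).trans hw.le) bot_le
    rw [hwP, mul_zero, mul_zero, mul_zero, mul_zero]
  · calc Z⁻¹ * (c * wP) = Z⁻¹ * (c * (w₁ * w₁⁻¹ * wP)) := by
          rw [ENNReal.mul_inv_cancel hw hfin, one_mul]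
      _ = Z⁻¹ * (c * w₁) * (w₁⁻¹ * wP) := by ring

/-- **Registered sub-goal `stub_sawDomainMarkov`** (crux stmt-CriticalPhenomena-1878): the exact DOMAIN MARKOV
PROPERTY of the critical SAW chord weights with all binders explicit = `weight_prefix_restrict`
(Kemppainen–Smirnov 2017, Remark 2.8, for the `x_c`-SAW; Madras–Slade 1993 §1.2). [folklore] -/
theorem stub_sawDomainMarkov :
    ∀ (Ω Ω' : Set ℂ) (δ : ℝ) (a b t : Site 2) (K : Set (Site 2)) (π : (discreteDomainGraph Ω δ).Walk a t),
      π.IsPath →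
      (∀ x y, (discreteDomainGraph Ω' δ).Adj x y ↔ ((discreteDomainGraph Ω δ).Adj x y ∧ x ∉ K ∧ y ∉ K)) →
      t ∉ K → (∀ v ∈ π.support, v ≠ t → v ∈ K) →
      (∀ v ∈ K, v ∉ π.support →
        ∀ p : (discreteDomainGraph Ω δ).Walk v b, ∃ x ∈ p.support, x ∈ π.support ∧ x ≠ t) →
      ∀ (P : List (Site 2) → Prop),
        SAW.weight Ω δ a b {γ | ∃ q : (discreteDomainGraph Ω δ).Walk t b,
            γ.walk = π.append q ∧ P q.support} =
          ENNReal.ofReal (SAW.criticalFugacity ^ π.length) * SAW.weight Ω' δ t b {γ' | P γ'.walk.support} :=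
  fun _ _ _ _ _ _ _ π hπ hadj ht hπK hcut P => weight_prefix_restrict π hπ hadj ht hπK hcut P

end Summit.CriticalPhenomena.SAWScalingLimit.Theorems.FKGToTraversalBound.ExcursionDomination

end
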